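import Summits.QuantumFields.YangMills.Theorems.FlatTubeReductionCoreTransferMomentsSq
import HarnessLib

/-!
# (C2-moments, step (iii″)) THE CORE TRANSFER DEFECT, SQUARED, IN CAUCHY–SCHWARZ FORM: `(I − c_qPρ̄)² ≤ 40(1+η_c)c_qPρ̄·Σ γ_m²·Y[m²] + 2η_c²(c_qPρ̄)²` — the input-variable moments enter
# only through colour-averaged SECOND-MOMENT central transfers `Y[m²]`, which the output integration turns into DIAGONAL reference-density moments
# (memo `Cruxes/NearFlatRatioLaw/Lines/ratepack-v7-moments-g18.md` §3; route `FlatTubeReduction`, crux K1 `NearFlatRatioLaw` stmt-QuantumFields-24720, line «ratepack_v2» skeleton v6,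
# stub `stub_hODpot_A`; seat `ym-line-ftr-p1` g18; R2b1 RECORD rung — no summit statement is proved here)

From `…CoreTransferMomentsSq.colour_fpFibreTransfer_sub_le_raw` (`|I − c_qPρ̄| ≤ 2Σ_m γ_m Y[m] + η_c c_qPρ̄`, `Y[m] = ∫_cρ_c T[m](c⁻¹(oT 1 x')c)`), Cauchy–Schwarz inside the fibre transfer
(`…CoreTransferMomentsSq.fpFibreTransfer_weighted_sq_le`: `T[m] ≤ √T[1]·√T[m²]`), weighted Cauchy–Schwarz in the colour (`sq_integral_mul_le`: `(∫ρ√T[1]√T[m²])² ≤ (∫ρT[1])(∫ρT[m²])`)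
and the UPPER half of lane A's central quasimode (`∫_cρ_cT[1] ≤ (1+η_c)c_qP(x')ρ̄`):
★★★ `colour_fpFibreTransfer_defect_sq_le_moments` —
`(I − c_qP(x')ρ̄)² ≤ 40(1+η_c)·c_qP(x')ρ̄·(e₀²·Y[Ω,W] + c₁'²(Y[Ω‖·‖⁴,W] + Y[Ω,W·G²]) + 9c₂'²(Y[Ω‖·‖⁸,W] + Y[Ω,W·G⁴])) + 2η_c²(c_qP(x')ρ̄)²`.
HONEST FRAMING: bookkeeping for a stub of the CONDITIONAL reduction route R2b1 (rate twin); the output integration (iv), (ρ2), (C1)-rate, the `L²` assembly, (B-ST) and the crux remain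
OPEN; femto rung R2b1 (RECORD label); not infinite volume, not a mass gap, not Clay.  No defs, no named facts, no `sorry`.
-/

set_option autoImplicit false

noncomputable section

open MeasureTheory Filter Topology Real
open scoped BigOperators
open Literature.MathematicalPhysics.QuantumFieldTheory
open Literature.MathematicalPhysics.QuantumLattice

namespace Summit.QuantumFields.YangMills.Theorems.FemtoTransferGap.TwoLattice.ConstTube

open Summit.QuantumFields.YangMills.Theorems.FemtoTransferGap
open Summit.QuantumFields.YangMills.Theorems.FemtoTransferGap.TwoLattice
open Summit.QuantumFields.YangMills.Theorems.FemtoTransferGap.TwoLattice.Avg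
open Summit.QuantumFields.YangMills.Theorems.FemtoTransferGap.TwoLattice.Stiff (LinkSpace)
open Summit.QuantumFields.YangMills.Theorems.TwistedTraceScaling.Negative.R33 (gaugeTransform_const_orthoTube)

variable {L : ℕ} [NeZero L]

/-- `(a₁ + a₂ + a₃ + a₄ + a₅)² ≤ 5(a₁² + a₂² + a₃² + a₄² + a₅²)`. [folklore] -/
theorem sq_sum_five_le (a₁ a₂ a₃ a₄ a₅ : ℝ) : (a₁ + a₂ + a₃ + a₄ + a₅) ^ 2 ≤ 5 * (a₁ ^ 2 + a₂ ^ 2 + a₃ ^ 2 + a₄ ^ 2 + a₅ ^ 2) := by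
  nlinarith [sq_nonneg (a₁ - a₂), sq_nonneg (a₁ - a₃), sq_nonneg (a₁ - a₄), sq_nonneg (a₁ - a₅), sq_nonneg (a₂ - a₃), sq_nonneg (a₂ - a₄), sq_nonneg (a₂ - a₅),
    sq_nonneg (a₃ - a₄), sq_nonneg (a₃ - a₅), sq_nonneg (a₄ - a₅)]

/-- ★ **Colour Cauchy–Schwarz from a pointwise square bound**: on a finite measure space, for bounded measurable `ρ, f, g, h ≥ 0` with `g² ≤ f·h` pointwise,
`(∫ρg)² ≤ (∫ρf)·(∫ρh)`. [folklore] -/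
theorem sq_integral_le_of_pointwise_sq_le {X : Type*} [MeasurableSpace X] (μ : Measure X) [IsFiniteMeasure μ] {ρ f g h : X → ℝ}
    (hρm : Measurable ρ) (hfm : Measurable f) (hgm : Measurable g) (hhm : Measurable h) (hρ0 : ∀ x, 0 ≤ ρ x) (hf0 : ∀ x, 0 ≤ f x) (hg0 : ∀ x, 0 ≤ g x) (hh0 : ∀ x, 0 ≤ h x)
    {Cρ Cf Cg Ch : ℝ} (hρb : ∀ x, ρ x ≤ Cρ) (hfb : ∀ x, f x ≤ Cf) (hgb : ∀ x, g x ≤ Cg) (hhb : ∀ x, h x ≤ Ch) (hpt : ∀ x, g x ^ 2 ≤ f x * h x) :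
    (∫ x, ρ x * g x ∂μ) ^ 2 ≤ (∫ x, ρ x * f x ∂μ) * ∫ x, ρ x * h x ∂μ := by
  -- bounded measurable products are integrable
  have hint : ∀ {a b : X → ℝ}, Measurable a → Measurable b → (∀ x, 0 ≤ a x) → (∀ x, 0 ≤ b x) → ∀ {Ca Cb : ℝ}, (∀ x, a x ≤ Ca) → (∀ x, b x ≤ Cb) →
      Integrable (fun x => ρ x * (a x * b x)) μ := by
    intro a b ham hbm ha0 hb0 Ca Cb hab hbb
    refine integrable_of_measurable_abs_le μ (hρm.mul (ham.mul hbm)) (C := Cρ * (Ca * Cb)) fun x => ?_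
    have hCρ : 0 ≤ Cρ := (hρ0 x).trans (hρb x)
    rw [abs_of_nonneg (mul_nonneg (hρ0 x) (mul_nonneg (ha0 x) (hb0 x)))]
    exact mul_le_mul (hρb x) (mul_le_mul (hab x) (hbb x) (hb0 x) ((ha0 x).trans (hab x))) (mul_nonneg (ha0 x) (hb0 x)) hCρ
  have hsf0 : ∀ x, 0 ≤ Real.sqrt (f x) := fun x => Real.sqrt_nonneg _
  have hsh0 : ∀ x, 0 ≤ Real.sqrt (h x) := fun x => Real.sqrt_nonneg _
  have hsfb : ∀ x, Real.sqrt (f x) ≤ Real.sqrt Cf := fun x => Real.sqrt_le_sqrt (hfb x)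
  have hshb : ∀ x, Real.sqrt (h x) ≤ Real.sqrt Ch := fun x => Real.sqrt_le_sqrt (hhb x)
  have hff := hint hfm.sqrt hfm.sqrt hsf0 hsf0 hsfb hsfb
  have hfg := hint hfm.sqrt hhm.sqrt hsf0 hsh0 hsfb hshb
  have hgg := hint hhm.sqrt hhm.sqrt hsh0 hsh0 hshb hshb
  have hff' : Integrable (fun x => ρ x * Real.sqrt (f x) ^ 2) μ := by simpa only [sq] using hff
  have hgg' : Integrable (fun x => ρ x * Real.sqrt (h x) ^ 2) μ := by simpa only [sq] using hgg
  have hcs := sq_integral_mul_le μ hρ0 hff' hfg hgg'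
  -- identify `(√f)² = f`, `(√h)² = h`
  have ef : ∫ x, ρ x * Real.sqrt (f x) ^ 2 ∂μ = ∫ x, ρ x * f x ∂μ := integral_congr_ae (ae_of_all _ fun x => by simp only [Real.sq_sqrt (hf0 x)])
  have eh : ∫ x, ρ x * Real.sqrt (h x) ^ 2 ∂μ = ∫ x, ρ x * h x ∂μ := integral_congr_ae (ae_of_all _ fun x => by simp only [Real.sq_sqrt (hh0 x)])
  rw [ef, eh] at hcs
  -- `∫ρg ≤ ∫ρ√f√h`
  have hgle : ∀ x, g x ≤ Real.sqrt (f x) * Real.sqrt (h x) := fun x => by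
    rw [← Real.sqrt_mul (hf0 x), ← Real.sqrt_sq (hg0 x)]
    exact Real.sqrt_le_sqrt (hpt x)
  have hρg : Integrable (fun x => ρ x * g x) μ := by
    refine integrable_of_measurable_abs_le μ (hρm.mul hgm) (C := Cρ * Cg) fun x => ?_
    rw [abs_of_nonneg (mul_nonneg (hρ0 x) (hg0 x))]
    exact mul_le_mul (hρb x) (hgb x) (hg0 x) ((hρ0 x).trans (hρb x))
  have h1 : ∫ x, ρ x * g x ∂μ ≤ ∫ x, ρ x * (Real.sqrt (f x) * Real.sqrt (h x)) ∂μ :=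
    integral_mono hρg hfg fun x => mul_le_mul_of_nonneg_left (hgle x) (hρ0 x)
  have h0 : 0 ≤ ∫ x, ρ x * g x ∂μ := integral_nonneg fun x => mul_nonneg (hρ0 x) (hg0 x)
  exact (pow_le_pow_left₀ h0 h1 2).trans hcs

/-- ★★★ **THE CORE TRANSFER DEFECT, SQUARED, IN CAUCHY–SCHWARZ FORM** (hypotheses as in `…CoreTransferMomentsSq.colour_fpFibreTransfer_sub_le_raw`, plus `0 ≤ c_q`, `0 ≤ P`, `0 ≤ η_c`).
[cite: Luscher1983, §3] -/
theorem colour_fpFibreTransfer_defect_sq_le_moments {β : ℝ} (hβ1 : 1 ≤ β) {Ω : LinkSpace L → ℝ} (hΩm : Measurable Ω) {CΩ : ℝ} (hCΩ : ∀ x, |Ω x| ≤ CΩ) (hΩ0 : ∀ x, 0 ≤ Ω x)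
    {W : (Site 3 L → SU2) → ℝ} (hW : Measurable W) {CW : ℝ} (hCW : ∀ g, |W g| ≤ CW) (hW0 : ∀ g, 0 ≤ W g)
    {δ δu T Tc R Rin Γ σ c₀ c₁ c₂ : ℝ} (hδ1 : δ ≤ 1 / 2) (hα1 : δ + δu ≤ 1) (hσ : σ < 2) (hRinT : Rin ≤ Tc)
    (hΩt : ∀ v : Edge 3 L → Fin 3 → ℝ, Ω (linkEmbed L v) ≠ 0 → v ∈ capBalancedSet L ∧ ‖linkEmbed L v‖ ≤ R)
    (hWc : ∀ g : Site 3 L → SU2, W g ≠ 0 → (∀ x, ‖su2Quat (g x) - 1‖ ≤ T) ∧ ‖∑ x, vecPart (g x)‖ ≤ Γ)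
    {P : LinkSpace L → ℝ} (hPinv : ∀ (g : SU2) (x : LinkSpace L), P (adL L g x) = P x) {cq ηc : ℝ} (hcq : 0 ≤ cq) (hP0 : ∀ x, 0 ≤ P x) (hηc : 0 ≤ ηc)
    (hC1 : ∀ v'' : Edge 3 L → Fin 3 → ℝ, v'' ∈ capBalancedSet L → (∀ (e : Edge 3 L) (a : Fin 3), |v'' e a| ≤ Tc) → ‖linkEmbed L v''‖ ≤ Rin →
      |fpFibreTransfer L β Ω W (orthoTube L 1 v'') 1 - cq * P (linkEmbed L v'')| ≤ ηc * (cq * P (linkEmbed L v'')))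
    (hS900 : Rin ^ 2 + R ^ 2 + (Fintype.card (Site 3 L) : ℝ) * T ^ 2 ≤ 1 / 900)
    (hc₀ : 216 * β * (δ + δu) * δ * Γ ≤ c₀)
    (hc₁ : 300000000 * ((Fintype.card (Edge 3 L) : ℝ) + (Fintype.card (Plaquette 3 L × Fin 3) : ℝ) + (Fintype.card (Plaquette 3 L) : ℝ)) *
      (β * ((δ + δu) + δ + (δ + δu) ^ 2 + δ ^ 2 + Real.sqrt σ) + Real.sqrt β / 2) ≤ c₁)
    (hc₂ : 300000000 * ((Fintype.card (Edge 3 L) : ℝ) + (Fintype.card (Plaquette 3 L × Fin 3) : ℝ) + (Fintype.card (Plaquette 3 L) : ℝ)) * (β + β * Real.sqrt β / 2) ≤ c₂)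
    (hc₀0 : 0 ≤ c₀) (hH1 : c₀ + c₁ * (Rin ^ 2 + R ^ 2 + (Fintype.card (Site 3 L) : ℝ) * T ^ 2) + c₂ * (Rin ^ 2 + R ^ 2 + (Fintype.card (Site 3 L) : ℝ) * T ^ 2) ^ 2 ≤ 1)
    (u' u : GaugeConfig 3 1 SU2) (hu' : ∀ k : Fin 3, ‖su2Quat (u' (0, k)) - 1‖ ≤ δ) (hS' : (L : ℝ) ^ 3 * wilsonAction su2Rep u' ≤ σ)
    (hu : ∀ k : Fin 3, ‖su2Quat (u (0, k)) - 1‖ ≤ δu) (hS : (L : ℝ) ^ 3 * wilsonAction su2Rep u ≤ σ)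
    {v' : Edge 3 L → Fin 3 → ℝ} (hv' : v' ∈ capBalancedSet L) (hx' : ‖linkEmbed L v'‖ ≤ Rin) :
    (∫ c, fpFibreTransfer L β Ω W (gaugeTransform (fun _ : Site 3 L => c⁻¹) (orthoTube L u' v')) u ∂haarProbability SU2 -
        cq * P (linkEmbed L v') * (avgKernel ((L : ℝ) ^ 3 * β) u' u / transferKernel su2Rep ((L : ℝ) ^ 3 * β) (1 : GaugeConfig 3 1 SU2) 1)) ^ 2 ≤
      40 * (1 + ηc) * (cq * P (linkEmbed L v') * (avgKernel ((L : ℝ) ^ 3 * β) u' u / transferKernel su2Rep ((L : ℝ) ^ 3 * β) (1 : GaugeConfig 3 1 SU2) 1)) *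
          ((c₀ + c₁ * ‖linkEmbed L v'‖ ^ 2 + 3 * c₂ * (‖linkEmbed L v'‖ ^ 2) ^ 2) ^ 2 *
              ∫ c, transferKernel su2Rep ((L : ℝ) ^ 3 * β) (gaugeTransform (fun _ : Site 3 1 => c⁻¹) u') u / transferKernel su2Rep ((L : ℝ) ^ 3 * β) (1 : GaugeConfig 3 1 SU2) 1 *
                fpFibreTransfer L β Ω W (gaugeTransform (fun _ : Site 3 L => c⁻¹) (orthoTube L 1 v')) 1 ∂haarProbability SU2 +
            c₁ ^ 2 * (∫ c, transferKernel su2Rep ((L : ℝ) ^ 3 * β) (gaugeTransform (fun _ : Site 3 1 => c⁻¹) u') u / transferKernel su2Rep ((L : ℝ) ^ 3 * β) (1 : GaugeConfig 3 1 SU2) 1 *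
                  fpFibreTransfer L β (fun x => Ω x * (‖x‖ ^ 2) ^ 2) W (gaugeTransform (fun _ : Site 3 L => c⁻¹) (orthoTube L 1 v')) 1 ∂haarProbability SU2 +
                ∫ c, transferKernel su2Rep ((L : ℝ) ^ 3 * β) (gaugeTransform (fun _ : Site 3 1 => c⁻¹) u') u / transferKernel su2Rep ((L : ℝ) ^ 3 * β) (1 : GaugeConfig 3 1 SU2) 1 *
                  fpFibreTransfer L β Ω (fun g => W g * (∑ x, ‖su2Quat (g x) - 1‖ ^ 2) ^ 2) (gaugeTransform (fun _ : Site 3 L => c⁻¹) (orthoTube L 1 v')) 1 ∂haarProbability SU2) +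
            9 * c₂ ^ 2 * (∫ c, transferKernel su2Rep ((L : ℝ) ^ 3 * β) (gaugeTransform (fun _ : Site 3 1 => c⁻¹) u') u / transferKernel su2Rep ((L : ℝ) ^ 3 * β) (1 : GaugeConfig 3 1 SU2) 1 *
                  fpFibreTransfer L β (fun x => Ω x * (‖x‖ ^ 2) ^ 4) W (gaugeTransform (fun _ : Site 3 L => c⁻¹) (orthoTube L 1 v')) 1 ∂haarProbability SU2 +
                ∫ c, transferKernel su2Rep ((L : ℝ) ^ 3 * β) (gaugeTransform (fun _ : Site 3 1 => c⁻¹) u') u / transferKernel su2Rep ((L : ℝ) ^ 3 * β) (1 : GaugeConfig 3 1 SU2) 1 *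
                  fpFibreTransfer L β Ω (fun g => W g * (∑ x, ‖su2Quat (g x) - 1‖ ^ 2) ^ 4) (gaugeTransform (fun _ : Site 3 L => c⁻¹) (orthoTube L 1 v')) 1 ∂haarProbability SU2)) +
        2 * ηc ^ 2 * (cq * P (linkEmbed L v') * (avgKernel ((L : ℝ) ^ 3 * β) u' u / transferKernel su2Rep ((L : ℝ) ^ 3 * β) (1 : GaugeConfig 3 1 SU2) 1)) ^ 2 := by
  haveI : SecondCountableTopology SU2 := secondCountableTopology_su2
  have hraw := colour_fpFibreTransfer_sub_le_raw hβ1 hΩm hCΩ hΩ0 hW hCW hW0 hδ1 hα1 hσ hRinT hΩt hWc hPinv hC1 hS900 hc₀ hc₁ hc₂ hc₀0 hH1 u' u hu' hS' hu hS hv' hx'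
  set B : ℝ := (L : ℝ) ^ 3 * β with hB
  set s' : ℝ := ‖linkEmbed L v'‖ ^ 2 with hs'
  set e₀ : ℝ := c₀ + c₁ * s' + 3 * c₂ * s' ^ 2 with he₀
  set KP : ℝ := cq * P (linkEmbed L v') with hKP
  have hKP0 : 0 ≤ KP := mul_nonneg hcq (hP0 _)
  have hK1 : 0 < transferKernel su2Rep B (1 : GaugeConfig 3 1 SU2) 1 := transferKernel_pos _ _ _ _
  have hCΩ0 : 0 ≤ CΩ := (abs_nonneg _).trans (hCΩ 0)
  have hCW0 : 0 ≤ CW := (abs_nonneg _).trans (hCW 1)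
  have hΩR : ∀ x, Ω x ≠ 0 → ‖x‖ ≤ R := fun x hx => by
    have hxe : linkEmbed L (fun e a => x (e, a)) = x := PiLp.ext fun ea => by simp [linkEmbed_apply]
    have h := (hΩt (fun e a => x (e, a)) (by rwa [hxe])).2
    rwa [hxe] at h
  obtain ⟨ha2m, ha2b, ha20⟩ := reweightedProfile_props hΩm hCΩ hΩ0 hΩR 2
  obtain ⟨ha4m, ha4b, ha40⟩ := reweightedProfile_props hΩm hCΩ hΩ0 hΩR 4
  obtain ⟨hb2m, hb2b, hb20⟩ := reweightedWeight_props hW hCW hW0 2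
  obtain ⟨hb4m, hb4b, hb40⟩ := reweightedWeight_props hW hCW hW0 4
  -- the slow ratio
  set ρ : SU2 → ℝ := fun c => transferKernel su2Rep B (gaugeTransform (fun _ : Site 3 1 => c⁻¹) u') u / transferKernel su2Rep B (1 : GaugeConfig 3 1 SU2) 1 with hρ
  obtain ⟨M1, hM1⟩ := exists_transferKernel_le su2Rep continuous_su2Rep B (L := 1)
  have hρm : Measurable ρ := by
    have hK : Measurable fun p : GaugeConfig 3 1 SU2 × GaugeConfig 3 1 SU2 => transferKernel su2Rep B p.1 p.2 :=
      (continuous_transferKernel su2Rep continuous_su2Rep B).measurable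
    have hc : Measurable fun c : SU2 => gaugeTransform (fun _ : Site 3 1 => c⁻¹) u' := by
      have hcu : Measurable fun _ : SU2 => u' := measurable_const
      have h := (measurable_constGaugeAction (L := 1)).comp (hcu.prodMk measurable_inv)
      simpa only [Function.comp_def] using h
    have hu0 : Measurable fun _ : SU2 => u := measurable_const
    have h := hK.comp (hc.prodMk hu0)
    exact (by simpa only [Function.comp_def] using h : Measurable fun c : SU2 => transferKernel su2Rep B (gaugeTransform (fun _ : Site 3 1 => c⁻¹) u') u).div_const _
  have hρ0 : ∀ c, 0 ≤ ρ c := fun c => div_nonneg (transferKernel_pos _ _ _ _).le hK1.le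
  have hρb : ∀ c, ρ c ≤ M1 / transferKernel su2Rep B (1 : GaugeConfig 3 1 SU2) 1 := fun c => div_le_div_of_nonneg_right (hM1 _ _) hK1.le
  have hρb' : ∀ c, |ρ c| ≤ M1 / transferKernel su2Rep B (1 : GaugeConfig 3 1 SU2) 1 := fun c => by rw [abs_of_nonneg (hρ0 c)]; exact hρb c
  have hρint : Integrable ρ (haarProbability SU2) := integrable_of_measurable_abs_le _ hρm hρb'
  have hρI : ∫ c, ρ c ∂haarProbability SU2 = avgKernel B u' u / transferKernel su2Rep B (1 : GaugeConfig 3 1 SU2) 1 := by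
    rw [hρ, integral_div, ← avgKernel_one_eq_integral_conj]
  -- the central colour functions: measurable, nonneg, bounded
  have hcol : ∀ {Ω' : LinkSpace L → ℝ} {W' : (Site 3 L → SU2) → ℝ}, Measurable Ω' → (∀ x, 0 ≤ Ω' x) → (∃ C', ∀ x, |Ω' x| ≤ C') → Measurable W' → (∀ g, 0 ≤ W' g) →
      (∃ C', ∀ g, |W' g| ≤ C') →
      Measurable (fun c : SU2 => fpFibreTransfer L β Ω' W' (gaugeTransform (fun _ : Site 3 L => c⁻¹) (orthoTube L 1 v')) 1) ∧
        (∀ c : SU2, 0 ≤ fpFibreTransfer L β Ω' W' (gaugeTransform (fun _ : Site 3 L => c⁻¹) (orthoTube L 1 v')) 1) ∧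
        ∃ B', ∀ c : SU2, fpFibreTransfer L β Ω' W' (gaugeTransform (fun _ : Site 3 L => c⁻¹) (orthoTube L 1 v')) 1 ≤ B' := by
    intro Ω' W' hΩ'm hΩ'0 ⟨CΩ', hCΩ'⟩ hW'm hW'0 ⟨CW', hCW'⟩
    obtain ⟨B', hB'⟩ := abs_fpFibreTransfer_le (L := L) β hCΩ' hCW' (1 : GaugeConfig 3 1 SU2)
    exact ⟨measurable_fpFibreTransfer_conj β hΩ'm hW'm _ 1, fun c => fpFibreTransfer_nonneg β hΩ'0 hW'0 _ _, B', fun c => (le_abs_self _).trans (hB' _)⟩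
  obtain ⟨hT0m, hT00, B0, hT0b⟩ := hcol hΩm hΩ0 ⟨CΩ, hCΩ⟩ hW hW0 ⟨CW, hCW⟩
  obtain ⟨hTa1m, hTa10, Ba1, hTa1b⟩ := hcol (reweightedProfile_props hΩm hCΩ hΩ0 hΩR 1).1 (reweightedProfile_props hΩm hCΩ hΩ0 hΩR 1).2.2 ⟨_, (reweightedProfile_props hΩm hCΩ hΩ0 hΩR 1).2.1⟩ hW hW0 ⟨CW, hCW⟩
  obtain ⟨hTa2m, hTa20, Ba2, hTa2b⟩ := hcol ha2m ha20 ⟨_, ha2b⟩ hW hW0 ⟨CW, hCW⟩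
  obtain ⟨hTa4m, hTa40, Ba4, hTa4b⟩ := hcol ha4m ha40 ⟨_, ha4b⟩ hW hW0 ⟨CW, hCW⟩
  obtain ⟨hTb1m, hTb10, Bb1, hTb1b⟩ := hcol hΩm hΩ0 ⟨CΩ, hCΩ⟩ (reweightedWeight_props hW hCW hW0 1).1 (reweightedWeight_props hW hCW hW0 1).2.2 ⟨_, (reweightedWeight_props hW hCW hW0 1).2.1⟩
  obtain ⟨hTb2m, hTb20, Bb2, hTb2b⟩ := hcol hΩm hΩ0 ⟨CΩ, hCΩ⟩ hb2m hb20 ⟨_, hb2b⟩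
  obtain ⟨hTb4m, hTb40, Bb4, hTb4b⟩ := hcol hΩm hΩ0 ⟨CΩ, hCΩ⟩ hb4m hb40 ⟨_, hb4b⟩
  -- pointwise squares inside the fibre transfer (`T[m]² ≤ T[1]·T[m²]`)
  have eW1 : (fun g : Site 3 L → SU2 => W g * (1 : ℝ)) = W := by funext g; ring
  have eW2 : (fun g : Site 3 L → SU2 => W g * (1 : ℝ) ^ 2) = W := by funext g; ring
  have eΩ1 : (fun x : LinkSpace L => Ω x * (1 : ℝ)) = Ω := by funext x; ring
  have eΩ2 : (fun x : LinkSpace L => Ω x * (1 : ℝ) ^ 2) = Ω := by funext x; ring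
  have ea12 : (fun x : LinkSpace L => Ω x * ((‖x‖ ^ 2) ^ 1) ^ 2) = fun x => Ω x * (‖x‖ ^ 2) ^ 2 := by funext x; ring
  have ea24 : (fun x : LinkSpace L => Ω x * ((‖x‖ ^ 2) ^ 2) ^ 2) = fun x => Ω x * (‖x‖ ^ 2) ^ 4 := by funext x; ring
  have eb12 : (fun g : Site 3 L → SU2 => W g * ((∑ x, ‖su2Quat (g x) - 1‖ ^ 2) ^ 1) ^ 2) = fun g => W g * (∑ x, ‖su2Quat (g x) - 1‖ ^ 2) ^ 2 := by funext g; ring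
  have eb24 : (fun g : Site 3 L → SU2 => W g * ((∑ x, ‖su2Quat (g x) - 1‖ ^ 2) ^ 2) ^ 2) = fun g => W g * (∑ x, ‖su2Quat (g x) - 1‖ ^ 2) ^ 4 := by funext g; ring
  have hsqa : ∀ (k : ℕ) (c : SU2), fpFibreTransfer L β (fun x => Ω x * (‖x‖ ^ 2) ^ k) W (gaugeTransform (fun _ : Site 3 L => c⁻¹) (orthoTube L 1 v')) 1 ^ 2 ≤
      fpFibreTransfer L β Ω W (gaugeTransform (fun _ : Site 3 L => c⁻¹) (orthoTube L 1 v')) 1 *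
        fpFibreTransfer L β (fun x => Ω x * ((‖x‖ ^ 2) ^ k) ^ 2) W (gaugeTransform (fun _ : Site 3 L => c⁻¹) (orthoTube L 1 v')) 1 := by
    intro k c
    have h := fpFibreTransfer_weighted_sq_le β hΩm hCΩ hΩ0 hW hCW hW0 (a := fun x => (‖x‖ ^ 2) ^ k) ((measurable_norm.pow_const 2).pow_const k)
      (fun x => by positivity) (Ca := (R ^ 2) ^ k) (by positivity) (fun x hx => pow_le_pow_left₀ (sq_nonneg _) (pow_le_pow_left₀ (norm_nonneg _) (hΩR x hx) 2) k)
      (b := fun _ => (1 : ℝ)) measurable_const (fun _ => zero_le_one) (Cb := 1) (fun _ => le_rfl) (gaugeTransform (fun _ : Site 3 L => c⁻¹) (orthoTube L 1 v')) 1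
    beta_reduce at h
    rw [eW1, eW2] at h
    exact h
  have hsqb : ∀ (j : ℕ) (c : SU2), fpFibreTransfer L β Ω (fun g => W g * (∑ x, ‖su2Quat (g x) - 1‖ ^ 2) ^ j) (gaugeTransform (fun _ : Site 3 L => c⁻¹) (orthoTube L 1 v')) 1 ^ 2 ≤
      fpFibreTransfer L β Ω W (gaugeTransform (fun _ : Site 3 L => c⁻¹) (orthoTube L 1 v')) 1 *
        fpFibreTransfer L β Ω (fun g => W g * ((∑ x, ‖su2Quat (g x) - 1‖ ^ 2) ^ j) ^ 2) (gaugeTransform (fun _ : Site 3 L => c⁻¹) (orthoTube L 1 v')) 1 := by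
    intro j c
    have h := fpFibreTransfer_weighted_sq_le β hΩm hCΩ hΩ0 hW hCW hW0 (a := fun _ => (1 : ℝ)) measurable_const (fun _ => zero_le_one) (Ca := 1) zero_le_one (fun _ _ => le_rfl)
      (b := fun g => (∑ x, ‖su2Quat (g x) - 1‖ ^ 2) ^ j) (measurable_gaugeDevSq.pow_const j) (fun g => pow_nonneg (gaugeDevSq_mem g).1 j)
      (Cb := (4 * Fintype.card (Site 3 L)) ^ j) (fun g => pow_le_pow_left₀ (gaugeDevSq_mem g).1 (gaugeDevSq_mem g).2 j) (gaugeTransform (fun _ : Site 3 L => c⁻¹) (orthoTube L 1 v')) 1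
    beta_reduce at h
    rw [eΩ1, eΩ2] at h
    exact h
  have hsqa1 := fun c => hsqa 1 c
  have hsqa2 := fun c => hsqa 2 c
  have hsqb1 := fun c => hsqb 1 c
  have hsqb2 := fun c => hsqb 2 c
  simp only [ea12] at hsqa1
  simp only [ea24] at hsqa2
  simp only [eb12] at hsqb1
  simp only [eb24] at hsqb2
  -- the central transfer at the rotated output is below `(1+η_c)·c_qP(x')`
  have hone : ∀ c : SU2, gaugeTransform (fun _ : Site 3 1 => c⁻¹) (1 : GaugeConfig 3 1 SU2) = 1 := fun c => by
    funext e; show c⁻¹ * 1 * c⁻¹⁻¹ = 1; group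
  have hT0le : ∀ c : SU2, fpFibreTransfer L β Ω W (gaugeTransform (fun _ : Site 3 L => c⁻¹) (orthoTube L 1 v')) 1 ≤ (1 + ηc) * KP := by
    intro c
    set v'' : Edge 3 L → Fin 3 → ℝ := colourRotate L (fun _ => c⁻¹) v' with hv''
    have hv''cap : v'' ∈ capBalancedSet L := colourRotate_mem_capBalancedSet L hv'
    have hx'' : linkEmbed L v'' = adL L c⁻¹ (linkEmbed L v') := by rw [hv'']; exact linkEmbed_colourRotate_const c⁻¹ v'
    have hnx'' : ‖linkEmbed L v''‖ = ‖linkEmbed L v'‖ := by rw [hx'', LinearIsometryEquiv.norm_map]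
    have hx''Rin : ‖linkEmbed L v''‖ ≤ Rin := by rw [hnx'']; exact hx'
    have hPx : P (linkEmbed L v'') = P (linkEmbed L v') := by rw [hx'', hPinv]
    have hv''T : ∀ (e : Edge 3 L) (a : Fin 3), |v'' e a| ≤ Tc := fun e a => by
      have h := PiLp.norm_apply_le (linkEmbed L v'') (e, a)
      rw [Real.norm_eq_abs, linkEmbed_apply] at h
      exact h.trans (hx''Rin.trans hRinT)
    have hq := (abs_le.mp (hC1 v'' hv''cap hv''T hx''Rin)).2
    rw [hPx] at hq
    rw [fpFibreTransfer_conj_orthoTube β Ω W c 1 1 hv', hone, ← hv'', hKP]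
    linarith
  -- colour Cauchy–Schwarz for the four weights, and the trivial one for `m = 1`
  haveI : IsFiniteMeasure (haarProbability SU2) := by infer_instance
  have hY0le : ∫ c, ρ c * fpFibreTransfer L β Ω W (gaugeTransform (fun _ : Site 3 L => c⁻¹) (orthoTube L 1 v')) 1 ∂haarProbability SU2 ≤
      (1 + ηc) * KP * ∫ c, ρ c ∂haarProbability SU2 := by
    rw [← integral_const_mul]
    refine integral_mono ?_ (hρint.const_mul _) fun c => ?_
    · exact integrable_of_measurable_abs_le _ (hρm.mul hT0m) (C := M1 / transferKernel su2Rep B (1 : GaugeConfig 3 1 SU2) 1 * B0) fun c => by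
        rw [abs_of_nonneg (mul_nonneg (hρ0 c) (hT00 c))]; exact mul_le_mul (hρb c) (hT0b c) (hT00 c) ((hρ0 c).trans (hρb c))
    · have := mul_le_mul_of_nonneg_left (hT0le c) (hρ0 c); linarith
  have csA2 := sq_integral_le_of_pointwise_sq_le (haarProbability SU2) hρm hT0m hTa1m hTa2m hρ0 hT00 hTa10 hTa20 hρb hT0b hTa1b hTa2b hsqa1
  have csB2 := sq_integral_le_of_pointwise_sq_le (haarProbability SU2) hρm hT0m hTb1m hTb2m hρ0 hT00 hTb10 hTb20 hρb hT0b hTb1b hTb2b hsqb1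
  have csA4 := sq_integral_le_of_pointwise_sq_le (haarProbability SU2) hρm hT0m hTa2m hTa4m hρ0 hT00 hTa20 hTa40 hρb hT0b hTa2b hTa4b hsqa2
  have csB4 := sq_integral_le_of_pointwise_sq_le (haarProbability SU2) hρm hT0m hTb2m hTb4m hρ0 hT00 hTb20 hTb40 hρb hT0b hTb2b hTb4b hsqb2
  -- abbreviations for the colour integrals
  set Y0 : ℝ := ∫ c, ρ c * fpFibreTransfer L β Ω W (gaugeTransform (fun _ : Site 3 L => c⁻¹) (orthoTube L 1 v')) 1 ∂haarProbability SU2 with hY0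
  set Ya1 : ℝ := ∫ c, ρ c * fpFibreTransfer L β (fun x => Ω x * (‖x‖ ^ 2) ^ 1) W (gaugeTransform (fun _ : Site 3 L => c⁻¹) (orthoTube L 1 v')) 1 ∂haarProbability SU2 with hYa1
  set Ya2 : ℝ := ∫ c, ρ c * fpFibreTransfer L β (fun x => Ω x * (‖x‖ ^ 2) ^ 2) W (gaugeTransform (fun _ : Site 3 L => c⁻¹) (orthoTube L 1 v')) 1 ∂haarProbability SU2 with hYa2
  set Ya4 : ℝ := ∫ c, ρ c * fpFibreTransfer L β (fun x => Ω x * (‖x‖ ^ 2) ^ 4) W (gaugeTransform (fun _ : Site 3 L => c⁻¹) (orthoTube L 1 v')) 1 ∂haarProbability SU2 with hYa4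
  set Yb1 : ℝ := ∫ c, ρ c * fpFibreTransfer L β Ω (fun g => W g * (∑ x, ‖su2Quat (g x) - 1‖ ^ 2) ^ 1) (gaugeTransform (fun _ : Site 3 L => c⁻¹) (orthoTube L 1 v')) 1 ∂haarProbability SU2 with hYb1
  set Yb2 : ℝ := ∫ c, ρ c * fpFibreTransfer L β Ω (fun g => W g * (∑ x, ‖su2Quat (g x) - 1‖ ^ 2) ^ 2) (gaugeTransform (fun _ : Site 3 L => c⁻¹) (orthoTube L 1 v')) 1 ∂haarProbability SU2 with hYb2
  set Yb4 : ℝ := ∫ c, ρ c * fpFibreTransfer L β Ω (fun g => W g * (∑ x, ‖su2Quat (g x) - 1‖ ^ 2) ^ 4) (gaugeTransform (fun _ : Site 3 L => c⁻¹) (orthoTube L 1 v')) 1 ∂haarProbability SU2 with hYb4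
  set ρbar : ℝ := avgKernel B u' u / transferKernel su2Rep B (1 : GaugeConfig 3 1 SU2) 1 with hρbar
  rw [hρI] at hY0le
  -- signs
  have hρbar0 : 0 ≤ ρbar := by rw [hρbar]; exact div_nonneg (avgKernel_pos _ _ _).le hK1.le
  have hY00 : 0 ≤ Y0 := integral_nonneg fun c => mul_nonneg (hρ0 c) (hT00 c)
  have hYa20 : 0 ≤ Ya2 := integral_nonneg fun c => mul_nonneg (hρ0 c) (hTa20 c)
  have hYb20 : 0 ≤ Yb2 := integral_nonneg fun c => mul_nonneg (hρ0 c) (hTb20 c)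
  have hYa40 : 0 ≤ Ya4 := integral_nonneg fun c => mul_nonneg (hρ0 c) (hTa40 c)
  have hYb40 : 0 ≤ Yb4 := integral_nonneg fun c => mul_nonneg (hρ0 c) (hTb40 c)
  have hA0 : 0 ≤ (1 + ηc) * KP * ρbar := by positivity
  -- `Y² ≤ ((1+ηc)KPρ̄)·Y[m²]`
  have f0 : Y0 ^ 2 ≤ (1 + ηc) * KP * ρbar * Y0 := by rw [sq]; exact mul_le_mul_of_nonneg_right hY0le hY00
  have fa1 : Ya1 ^ 2 ≤ (1 + ηc) * KP * ρbar * Ya2 := csA2.trans (mul_le_mul_of_nonneg_right hY0le hYa20)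
  have fb1 : Yb1 ^ 2 ≤ (1 + ηc) * KP * ρbar * Yb2 := csB2.trans (mul_le_mul_of_nonneg_right hY0le hYb20)
  have fa2 : Ya2 ^ 2 ≤ (1 + ηc) * KP * ρbar * Ya4 := csA4.trans (mul_le_mul_of_nonneg_right hY0le hYa40)
  have fb2 : Yb2 ^ 2 ≤ (1 + ηc) * KP * ρbar * Yb4 := csB4.trans (mul_le_mul_of_nonneg_right hY0le hYb40)
  -- the raw bound squared
  set Sg : ℝ := e₀ * Y0 + c₁ * (Ya1 + Yb1) + 3 * c₂ * (Ya2 + Yb2) with hSg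
  have hraw' : |(∫ c, fpFibreTransfer L β Ω W (gaugeTransform (fun _ : Site 3 L => c⁻¹) (orthoTube L u' v')) u ∂haarProbability SU2) - KP * ρbar| ≤ 2 * Sg + ηc * (KP * ρbar) :=
    hraw
  have hsq : ((∫ c, fpFibreTransfer L β Ω W (gaugeTransform (fun _ : Site 3 L => c⁻¹) (orthoTube L u' v')) u ∂haarProbability SU2) - KP * ρbar) ^ 2 ≤ (2 * Sg + ηc * (KP * ρbar)) ^ 2 :=
    sq_le_sq' (abs_le.mp hraw').1 (abs_le.mp hraw').2
  have hsq2 : (2 * Sg + ηc * (KP * ρbar)) ^ 2 ≤ 8 * Sg ^ 2 + 2 * (ηc * (KP * ρbar)) ^ 2 := by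
    have e : (2 * Sg + ηc * (KP * ρbar)) ^ 2 = 8 * Sg ^ 2 + 2 * (ηc * (KP * ρbar)) ^ 2 - (2 * Sg - ηc * (KP * ρbar)) ^ 2 := by ring
    rw [e]; linarith [sq_nonneg (2 * Sg - ηc * (KP * ρbar))]
  have hSsq : Sg ^ 2 ≤ 5 * ((e₀ * Y0) ^ 2 + (c₁ * Ya1) ^ 2 + (c₁ * Yb1) ^ 2 + (3 * c₂ * Ya2) ^ 2 + (3 * c₂ * Yb2) ^ 2) := by
    have h := sq_sum_five_le (e₀ * Y0) (c₁ * Ya1) (c₁ * Yb1) (3 * c₂ * Ya2) (3 * c₂ * Yb2)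
    have e : e₀ * Y0 + c₁ * Ya1 + c₁ * Yb1 + 3 * c₂ * Ya2 + 3 * c₂ * Yb2 = Sg := by rw [hSg]; ring
    rwa [e] at h
  have g0 : (e₀ * Y0) ^ 2 ≤ e₀ ^ 2 * ((1 + ηc) * KP * ρbar * Y0) := by rw [mul_pow]; exact mul_le_mul_of_nonneg_left f0 (sq_nonneg _)
  have ga1 : (c₁ * Ya1) ^ 2 ≤ c₁ ^ 2 * ((1 + ηc) * KP * ρbar * Ya2) := by rw [mul_pow]; exact mul_le_mul_of_nonneg_left fa1 (sq_nonneg _)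
  have gb1 : (c₁ * Yb1) ^ 2 ≤ c₁ ^ 2 * ((1 + ηc) * KP * ρbar * Yb2) := by rw [mul_pow]; exact mul_le_mul_of_nonneg_left fb1 (sq_nonneg _)
  have ga2 : (3 * c₂ * Ya2) ^ 2 ≤ (3 * c₂) ^ 2 * ((1 + ηc) * KP * ρbar * Ya4) := by rw [mul_pow (3 * c₂)]; exact mul_le_mul_of_nonneg_left fa2 (sq_nonneg _)
  have gb2 : (3 * c₂ * Yb2) ^ 2 ≤ (3 * c₂) ^ 2 * ((1 + ηc) * KP * ρbar * Yb4) := by rw [mul_pow (3 * c₂)]; exact mul_le_mul_of_nonneg_left fb2 (sq_nonneg _)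
  have hSsq8 := mul_le_mul_of_nonneg_left hSsq (by norm_num : (0 : ℝ) ≤ 8)
  have hfin : ((∫ c, fpFibreTransfer L β Ω W (gaugeTransform (fun _ : Site 3 L => c⁻¹) (orthoTube L u' v')) u ∂haarProbability SU2) - KP * ρbar) ^ 2 ≤
      40 * (1 + ηc) * (KP * ρbar) * (e₀ ^ 2 * Y0 + c₁ ^ 2 * (Ya2 + Yb2) + 9 * c₂ ^ 2 * (Ya4 + Yb4)) + 2 * ηc ^ 2 * (KP * ρbar) ^ 2 := by
    linarith [hsq, hsq2, hSsq8, g0, ga1, gb1, ga2, gb2]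
  exact hfin

end Summit.QuantumFields.YangMills.Theorems.FemtoTransferGap.TwoLattice.ConstTube

end
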